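import Mathlib
import HarnessLib
import Summits.ResolutionOfSingularities.ResolutionOfSingularities.Theorems.WildQuotientsWildQuotientResolutionS1aRecoordStep
import Summits.ResolutionOfSingularities.ResolutionOfSingularities.Theorems.WildQuotientsWildQuotientResolutionS1aModelNodeCentre
import Summits.ResolutionOfSingularities.ResolutionOfSingularities.Theorems.WildQuotientsWildQuotientResolutionS1aKillInitialJordan

/-!
# S1a — LINEAR RE-COORDINATION OF A FREE MODEL, used only for K1′ of a centre `(x_{v₀}, a·x_{v₁} + b·x_{v₂})` in `k[x_ι][1/h]`

[OURS · L1 W4.5c · lead-1 g15; R3 (`lines_killsIn_two`, RULING R-F15l / CLARIFICATION R-F15m-1 «a polynomial-triangular recoordination lemma in the style of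
✓p702656»): the components of the line-arrangement class on a producer chart are `V(x₀′, ℓᵢ(x₁′, x₂′))` with `ℓᵢ` a LINEAR FORM; the abstract member producer
✓`exists_isPrincipalCentre_of_nodePowerChains` needs K1′ for `(x₀′, ℓᵢ)`, which is transported here from the variable case ✓`isRegular_algebraMap_X_away` /
✓`isRegularRing_quotient_X_away` along a linear automorphism; pattern ✓`exists_shear` / ✓`exists_awayEquiv_of_algEquiv` (`…S1aRecoordStep`)] — NOT statements of the
manuscript; counted 0; AI-level work, weaker than expert review. Crux stmt-ResolutionOfSingularities-17941 `CyclicQuotientFourfolds`, line `s1a-logminvertex` v13.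

* `exists_linShear` — the `k`-algebra automorphism `x_{v₂} ↦ a·x_{v₁} + b·x_{v₂}` (`b ≠ 0`), other variables fixed, with its inverse on the variables;
* `eval_point_algEquiv` — `eval (i ↦ g(φ⁻¹xᵢ)) (φ q) = eval g q` (points move contravariantly);
* `isRegular_away_pair_of_algEquiv` — K1′ for `(x_{v₀}, L)` in `k[x][1/h]` from an automorphism `φ` with `φ⁻¹x_{v₀} = x_{v₀}`, `φ⁻¹x_{vt} = L` and a point of
  `V(x_{v₀}, x_{vt})` off `φ h = 0`;
* ★★ `isRegular_away_X_linForm` — K1′ for `(x_{v₀}, a·x_{v₁} + b·x_{v₂})` (`(a, b) ≠ 0`, `v₀, v₁, v₂` distinct) in `k[x_ι][1/h]` given a point `g` with `g_{v₀} = 0`,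
  `a g_{v₁} + b g_{v₂} = 0`, `h(g) ≠ 0`: the sequence is regular and the quotient is a regular ring.
-/

set_option linter.dupNamespace false

noncomputable section

open MvPolynomial
open Summit.ResolutionOfSingularities.ResolutionOfSingularities.Theorems.WildQuotientResolution.S1
open Summit.ResolutionOfSingularities.ResolutionOfSingularities.Theorems.WildQuotientResolution.S1.ModelNode

namespace Summit.ResolutionOfSingularities.ResolutionOfSingularities.Theorems.WildQuotientResolution.S1.FreeModel

variable (k : Type) [Field k] {ι : Type} [DecidableEq ι]

/-- **The linear shear** `x_{v₂} ↦ a·x_{v₁} + b·x_{v₂}` (`b ≠ 0`, `v₁ ≠ v₂`), all other variables fixed, as a `k`-algebra automorphism of `k[x_ι]`, with its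
inverse `x_{v₂} ↦ b⁻¹(x_{v₂} − a·x_{v₁})`. [folklore] -/
theorem exists_linShear (v₁ v₂ : ι) (hv : v₁ ≠ v₂) (a b : k) (hb : b ≠ 0) :
    ∃ α : MvPolynomial ι k ≃ₐ[k] MvPolynomial ι k, α (X v₂) = C a * X v₁ + C b * X v₂ ∧ (∀ l, l ≠ v₂ → α (X l) = X l) ∧
      α.symm (X v₂) = C b⁻¹ * (X v₂ - C a * X v₁) ∧ (∀ l, l ≠ v₂ → α.symm (X l) = X l) := by
  let f : MvPolynomial ι k →ₐ[k] MvPolynomial ι k := aeval fun l => if l = v₂ then C a * X v₁ + C b * X v₂ else X l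
  let g : MvPolynomial ι k →ₐ[k] MvPolynomial ι k := aeval fun l => if l = v₂ then C b⁻¹ * (X v₂ - C a * X v₁) else X l
  have hf0 : f (X v₂) = C a * X v₁ + C b * X v₂ := by rw [aeval_X, if_pos rfl]
  have hf : ∀ l, l ≠ v₂ → f (X l) = X l := fun l h => by rw [aeval_X, if_neg h]
  have hg0 : g (X v₂) = C b⁻¹ * (X v₂ - C a * X v₁) := by rw [aeval_X, if_pos rfl]
  have hg : ∀ l, l ≠ v₂ → g (X l) = X l := fun l h => by rw [aeval_X, if_neg h]
  have hfC : ∀ c : k, f (C c) = C c := fun c => f.commutes c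
  have hgC : ∀ c : k, g (C c) = C c := fun c => g.commutes c
  have hbb : (C b⁻¹ : MvPolynomial ι k) * C b = 1 := by rw [← C_mul, inv_mul_cancel₀ hb, C_1]
  have hfg : f.comp g = AlgHom.id k _ := by
    refine algHom_ext fun l => ?_
    by_cases h : l = v₂
    · subst h
      rw [AlgHom.comp_apply, hg0, map_mul, map_sub, map_mul, hfC, hfC, AlgHom.id_apply, hf0, hf _ hv]
      calc C b⁻¹ * (C a * X v₁ + C b * X l - C a * X v₁) = (C b⁻¹ * C b) * X l := by ring
        _ = X l := by rw [hbb, one_mul]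
    · rw [AlgHom.comp_apply, hg l h, AlgHom.id_apply, hf l h]
  have hgf : g.comp f = AlgHom.id k _ := by
    refine algHom_ext fun l => ?_
    by_cases h : l = v₂
    · subst h
      rw [AlgHom.comp_apply, hf0, map_add, map_mul, map_mul, hgC, hgC, AlgHom.id_apply, hg0, hg _ hv]
      calc C a * X v₁ + C b * (C b⁻¹ * (X l - C a * X v₁)) = C a * X v₁ + (C b⁻¹ * C b) * (X l - C a * X v₁) := by ring
        _ = X l := by rw [hbb]; ring
    · rw [AlgHom.comp_apply, hf l h, AlgHom.id_apply, hg l h]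
  exact ⟨AlgEquiv.ofAlgHom f g hfg hgf, hf0, hf, hg0, hg⟩

omit [DecidableEq ι] in
/-- **Points move contravariantly**: `eval (i ↦ g(φ⁻¹ xᵢ)) (φ q) = eval g q` for a `k`-algebra automorphism `φ` of `k[x_ι]`. [folklore] -/
theorem eval_point_algEquiv (φ : MvPolynomial ι k ≃ₐ[k] MvPolynomial ι k) (g : ι → k) (q : MvPolynomial ι k) :
    MvPolynomial.eval (fun i => MvPolynomial.eval g (φ.symm (X i))) (φ q) = MvPolynomial.eval g q := by
  have key : ∀ r : MvPolynomial ι k, MvPolynomial.eval g (φ.symm r) = MvPolynomial.eval (fun i => MvPolynomial.eval g (φ.symm (X i))) r := by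
    intro r
    induction r using MvPolynomial.induction_on with
    | C c => rw [← MvPolynomial.algebraMap_eq, AlgEquiv.commutes, MvPolynomial.algebraMap_eq, MvPolynomial.eval_C, MvPolynomial.eval_C]
    | add p q hp hq => rw [map_add, map_add, hp, hq, map_add]
    | mul_X p i hp => rw [map_mul, map_mul, hp, map_mul, MvPolynomial.eval_X]
  rw [← key, φ.symm_apply_apply]

omit [DecidableEq ι] in
/-- **K1′ transported along a linear automorphism.** `φ` a `k`-algebra automorphism of `k[x_ι]` with `φ⁻¹ x_{v₀} = x_{v₀}`, `φ⁻¹ x_{vt} = L` (`v₀ ≠ vt`), and a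
point `g′` of `V(x_{v₀}, x_{vt})` off `φ h = 0`: then `(x_{v₀}, L)` is a regular sequence in `k[x][1/h]` with regular quotient. [OURS · L1 W4.5c; folklore] -/
theorem isRegular_away_pair_of_algEquiv [Finite ι] (hh : MvPolynomial ι k) (v₀ vt : ι) (hv : v₀ ≠ vt) (L : MvPolynomial ι k)
    (φ : MvPolynomial ι k ≃ₐ[k] MvPolynomial ι k) (hφ0 : φ.symm (X v₀) = X v₀) (hφt : φ.symm (X vt) = L)
    (g' : ι → k) (hg0 : g' v₀ = 0) (hgt : g' vt = 0) (hu : MvPolynomial.eval g' (φ hh) ≠ 0) :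
    RingTheory.Sequence.IsRegular (Localization.Away hh)
        (List.ofFn (![algebraMap (MvPolynomial ι k) (Localization.Away hh) (X v₀), algebraMap (MvPolynomial ι k) (Localization.Away hh) L] :
          Fin 2 → Localization.Away hh)) ∧
      IsRegularRing (Localization.Away hh ⧸ Ideal.span (Set.range
        (![algebraMap (MvPolynomial ι k) (Localization.Away hh) (X v₀), algebraMap (MvPolynomial ι k) (Localization.Away hh) L] : Fin 2 → Localization.Away hh))) := by
  classical
  obtain ⟨Θ, hΘ⟩ := exists_awayEquiv_of_algEquiv k φ hh
  have hΘs : ∀ q, Θ.symm (algebraMap (MvPolynomial ι k) (Localization.Away (φ hh)) q) = algebraMap (MvPolynomial ι k) (Localization.Away hh) (φ.symm q) := by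
    intro q
    apply Θ.injective
    rw [Θ.apply_symm_apply, hΘ, φ.apply_symm_apply]
  have hvinj : Function.Injective (![v₀, vt] : Fin 2 → ι) := by
    intro i j hij
    fin_cases i <;> fin_cases j
    · rfl
    · exact absurd hij hv
    · exact absurd hij.symm hv
    · rfl
  have h1 := isRegular_algebraMap_X_away k (φ hh) (![v₀, vt] : Fin 2 → ι) hvinj g' (fun i => by fin_cases i; exacts [hg0, hgt]) hu
  have h2 := isRegularRing_quotient_X_away k (φ hh) (![v₀, vt] : Fin 2 → ι)
  have hfun : (⇑Θ.symm ∘ fun i => algebraMap (MvPolynomial ι k) (Localization.Away (φ hh)) (X ((![v₀, vt] : Fin 2 → ι) i))) =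
      (![algebraMap (MvPolynomial ι k) (Localization.Away hh) (X v₀), algebraMap (MvPolynomial ι k) (Localization.Away hh) L] : Fin 2 → Localization.Away hh) := by
    funext i
    fin_cases i
    · change Θ.symm (algebraMap _ _ (X v₀)) = algebraMap _ _ (X v₀); rw [hΘs, hφ0]
    · change Θ.symm (algebraMap _ _ (X vt)) = algebraMap _ _ L; rw [hΘs, hφt]
  refine ⟨?_, ?_⟩
  · have h := KillCert.IsRegular.of_ringEquiv_ofFn Θ.symm _ h1
    rwa [hfun] at h
  · have h := KillCert.isRegularRing_quotient_of_ringEquiv Θ.symm _ h2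
    rwa [hfun] at h

/-- ★★ **K1′ for `(x_{v₀}, a·x_{v₁} + b·x_{v₂})` in `k[x_ι][1/h]`**: `v₀, v₁, v₂` distinct, `(a, b) ≠ 0`, and a point `g` with `g_{v₀} = 0`, `a g_{v₁} + b g_{v₂} = 0`
and `h(g) ≠ 0`. [OURS · L1 W4.5c · R3, K1′ of the line components; folklore] -/
theorem isRegular_away_X_linForm [Finite ι] (hh : MvPolynomial ι k) (v₀ v₁ v₂ : ι) (h01 : v₀ ≠ v₁) (h02 : v₀ ≠ v₂) (h12 : v₁ ≠ v₂) (a b : k)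
    (hab : a ≠ 0 ∨ b ≠ 0) (g : ι → k) (hg0 : g v₀ = 0) (hgL : a * g v₁ + b * g v₂ = 0) (hu : MvPolynomial.eval g hh ≠ 0) :
    RingTheory.Sequence.IsRegular (Localization.Away hh)
        (List.ofFn (![algebraMap (MvPolynomial ι k) (Localization.Away hh) (X v₀), algebraMap (MvPolynomial ι k) (Localization.Away hh) (C a * X v₁ + C b * X v₂)] :
          Fin 2 → Localization.Away hh)) ∧
      IsRegularRing (Localization.Away hh ⧸ Ideal.span (Set.range
        (![algebraMap (MvPolynomial ι k) (Localization.Away hh) (X v₀), algebraMap (MvPolynomial ι k) (Localization.Away hh) (C a * X v₁ + C b * X v₂)] :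
          Fin 2 → Localization.Away hh))) := by
  classical
  by_cases hb : b = 0
  · -- `L = a·x_{v₁}`, `a ≠ 0`: shear in the variable `v₁`
    have ha : a ≠ 0 := hab.resolve_right (not_not.mpr hb)
    obtain ⟨α, hα0, hα, -, -⟩ := exists_linShear k v₂ v₁ (Ne.symm h12) b a ha
    have hL : α (X v₁) = C a * X v₁ + C b * X v₂ := by rw [hα0, add_comm]
    refine isRegular_away_pair_of_algEquiv k hh v₀ v₁ h01 _ α.symm (by rw [AlgEquiv.symm_symm, hα _ (Ne.symm h01).symm]) (by rw [AlgEquiv.symm_symm, hL])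
      (fun i => MvPolynomial.eval g (α (X i))) (by rw [hα _ h01, MvPolynomial.eval_X, hg0])
      (by rw [hL, map_add, map_mul, map_mul, MvPolynomial.eval_C, MvPolynomial.eval_C, MvPolynomial.eval_X, MvPolynomial.eval_X, hgL]) ?_
    have h := eval_point_algEquiv k α.symm g hh
    simp only [AlgEquiv.symm_symm] at h
    rwa [h]
  · obtain ⟨α, hα0, hα, -, -⟩ := exists_linShear k v₁ v₂ h12 a b hb
    refine isRegular_away_pair_of_algEquiv k hh v₀ v₂ h02 _ α.symm (by rw [AlgEquiv.symm_symm, hα _ h02]) (by rw [AlgEquiv.symm_symm, hα0])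
      (fun i => MvPolynomial.eval g (α (X i))) (by rw [hα _ h02, MvPolynomial.eval_X, hg0])
      (by rw [hα0, map_add, map_mul, map_mul, MvPolynomial.eval_C, MvPolynomial.eval_C, MvPolynomial.eval_X, MvPolynomial.eval_X, hgL]) ?_
    have h := eval_point_algEquiv k α.symm g hh
    simp only [AlgEquiv.symm_symm] at h
    rwa [h]

end Summit.ResolutionOfSingularities.ResolutionOfSingularities.Theorems.WildQuotientResolution.S1.FreeModel

end
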